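import Mathlib
import HarnessLib
import Summits.ResolutionOfSingularities.ResolutionOfSingularities.Theorems.WildQuotientsWildQuotientResolutionTerminalBlowupChartPackage
import Summits.ResolutionOfSingularities.ResolutionOfSingularities.Theorems.WildQuotientsWildQuotientResolutionTerminalBlowupSpec
import Summits.ResolutionOfSingularities.ResolutionOfSingularities.Theorems.WildQuotientsWildQuotientResolutionJordanThreeChartAlgebra
import Summits.ResolutionOfSingularities.ResolutionOfSingularities.Theorems.WildQuotientsWildQuotientResolutionJordanThreeK3ChartAlgebraCharThree
import Summits.ResolutionOfSingularities.ResolutionOfSingularities.Theorems.WildQuotientsWildQuotientResolutionJordanThreeCentre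
import Summits.ResolutionOfSingularities.ResolutionOfSingularities.Theorems.WildQuotientsWildQuotientResolutionJordanThreeOrder

/-!
# Rung V3, one-blow-up model: the divisorial clause for `Bl_{K₃} 𝔸ⁿ`
(crux stmt-ResolutionOfSingularities-15640 `WildQuotients.WildQuotientResolution`, line `Sketch`;
chain w45c rung V3, design of record `L/res-L1-w45c-lead-1/V3-K3-DESIGN.md`; [OURS · L1 W4.5c] —
NOT a statement of any manuscript.)

For the `J₃` datum `σ x_a = x_a`, `σ x_b = x_b + x_a`, `σ x_c = x_c + x_b` (passengers fixed) over a
field of characteristic `3`, the monomial ideal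
`K₃ = (x_a⁴, x_a³x_b, x_a²x_b³, x_a x_b⁴, x_b⁶)` is `⟨σ⟩`-stable and `Bl_{K₃} 𝔸ⁿ` is the
three-step plain tower of CRUX-PLAN v4 §V3.1 in one go. This file proves the Király–Lütkebohmert
**divisorial clause** `hdiv` for the lifted action on ANY blow-up `π : V → 𝔸ⁿ` along `K̃₃`
(`IsBlowup.liftAction`): at every point `v` fixed by the lift of `g ∈ ⟨σ⟩` the augmentation ideal
`⟨(stalkSpecializes ≫ (ρV g)^♯_v) y - y⟩` of `𝒪_{V,v}` is principal
(`JordanThree.K3.isPrincipal_stalkAug_liftAction`).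

Proof: `g = 1` lifts to the identity (ideal `⊥`). For `g ≠ 1`, `g⁻¹ = σᵐ` with `3 ∤ m`
(`JordanThree.pow_three_eq_one`), so the stalk action `b` of `ρ g = Spec (g⁻¹)` at `s = π v`
sends the germs of `x_a, x_b` to those of `x_a, x_b + m x_a` (`TerminalBlowup.stalkAction_germ`)
and has augmentation ideal `(x_a, x_b)·𝒪_s` (`JordanThree.span_smul_sub_eq_centre`, localised).
The chart package (`TerminalBlowup.stalkAug_of_chartPackage`) presents `𝒪_{V,v}` as a localisation
of a Rees chart `𝒪_s[K₃/m_j]`, `JordanThree.span_sub_eq_map_sup_span_of_chart` identifies the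
augmentation ideal upstairs with `(x_a, x_b)·𝒪_{V,v} + (a(m_l/m_j) - m_l/m_j : l ≠ j)`, and the
chart algebra `JordanThree.K3.chart_isPrincipal` (five charts; characteristic `3` on two of them)
shows this ideal is principal.
-/

-- single-problem summit: the doubled namespace component `ResolutionOfSingularities` is forced
set_option linter.dupNamespace false

noncomputable section

open CategoryTheory AlgebraicGeometry TopologicalSpace IsLocalRing MvPolynomial
open Literature.AlgebraicGeometry.Resolution
open scoped Pointwise

namespace Summit.ResolutionOfSingularities.ResolutionOfSingularities.Theorems.WildQuotientResolution.JordanThree.K3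

/-- Every `1 ≠ g ∈ ⟨σ⟩` is `σᵐ` with `m` a unit in `k` (characteristic `3`, `σ³ = 1`). [folklore] -/
theorem exists_pow_eq_of_ne_one (k : Type) [Field k] [CharP k 3] (n : ℕ)
    (σ : MvPolynomial (Fin n) k ≃ₐ[k] MvPolynomial (Fin n) k) (a b c : Fin n)
    (hab : a ≠ b) (hac : a ≠ c) (hb : σ (X b) = X b + X a) (hc : σ (X c) = X c + X b)
    (hσ : ∀ i, i ≠ b → i ≠ c → σ (X i) = X i)
    (g : Subgroup.zpowers σ) (hg : g ≠ 1) :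
    ∃ m : ℕ, σ ^ m = (g : MvPolynomial (Fin n) k ≃ₐ[k] MvPolynomial (Fin n) k) ∧ (m : k) ≠ 0 := by
  have hσ3 : σ ^ 3 = 1 := pow_three_eq_one k n σ a b c hab hac hb hc hσ
  have hfin : IsOfFinOrder σ := isOfFinOrder_iff_pow_eq_one.mpr ⟨3, by norm_num, hσ3⟩
  obtain ⟨m, hm⟩ : (g : MvPolynomial (Fin n) k ≃ₐ[k] MvPolynomial (Fin n) k) ∈ Submonoid.powers σ :=
    hfin.mem_powers_iff_mem_zpowers.mpr g.2
  have hm' : σ ^ m = (g : MvPolynomial (Fin n) k ≃ₐ[k] MvPolynomial (Fin n) k) := hm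
  refine ⟨m, hm', fun h => ?_⟩
  have hdvd : 3 ∣ m := (CharP.cast_eq_zero_iff k 3 m).mp h
  obtain ⟨l, rfl⟩ := hdvd
  apply hg
  apply Subtype.ext
  change (g : MvPolynomial (Fin n) k ≃ₐ[k] MvPolynomial (Fin n) k) = 1
  rw [← hm', pow_mul, hσ3, one_pow]

-- the stalk / Rees-chart unifications of this assembly are individually cheap but numerous
set_option maxHeartbeats 1600000 in
/-- **The divisorial clause for the one-blow-up model `Bl_{K₃} 𝔸ⁿ` of the `J₃` datum in
characteristic 3.** Let `σ x_a = x_a`, `σ x_b = x_b + x_a`, `σ x_c = x_c + x_b`, `σ xᵢ = xᵢ`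
otherwise, over a field `k` with `char k = 3`; `K : Fin 5 → k[x]` the generators
`x_a⁴, x_a³x_b, x_a²x_b³, x_a x_b⁴, x_b⁶` of `K₃`; `ρ g = Spec (g⁻¹)` the action of `⟨σ⟩` on `𝔸ⁿ`;
`π : V → 𝔸ⁿ` any blow-up along `K̃₃` with `K̃₃` `ρ`-stable (`hJ`). Then for every `g ∈ ⟨σ⟩` and
every point `v` fixed by the lifted automorphism `(liftAction ρ) g`, the augmentation ideal
`⟨(stalkSpecializes ≫ (liftAction ρ g)^♯_v) y - y : y ∈ 𝒪_{V,v}⟩` is principal.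
[OURS · L1 W4.5c] [folklore; assembly of landed decls] -/
theorem isPrincipal_stalkAug_liftAction (k : Type) [Field k] [CharP k 3] (n : ℕ)
    (σ : MvPolynomial (Fin n) k ≃ₐ[k] MvPolynomial (Fin n) k) (a b c : Fin n)
    (hab : a ≠ b) (hac : a ≠ c) (hb : σ (X b) = X b + X a) (hc : σ (X c) = X c + X b)
    (hσ : ∀ i, i ≠ b → i ≠ c → σ (X i) = X i)
    (K : Fin 5 → MvPolynomial (Fin n) k)
    (hK0 : K 0 = X a ^ 4) (hK1 : K 1 = X a ^ 3 * X b) (hK2 : K 2 = X a ^ 2 * X b ^ 3)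
    (hK3 : K 3 = X a * X b ^ 4) (hK4 : K 4 = X b ^ 6)
    (ρ : ↥(Subgroup.zpowers σ) →* Aut (Spec (CommRingCat.of (MvPolynomial (Fin n) k))))
    (hρ : ∀ g : ↥(Subgroup.zpowers σ), (ρ g).hom = Spec.map (CommRingCat.ofHom
      ((MulSemiringAction.toRingEquiv (↥(Subgroup.zpowers σ)) (MvPolynomial (Fin n) k) g⁻¹ :
        MvPolynomial (Fin n) k ≃+* MvPolynomial (Fin n) k) :
          MvPolynomial (Fin n) k →+* MvPolynomial (Fin n) k)))
    {V : Scheme.{0}} {π : V ⟶ Spec (CommRingCat.of (MvPolynomial (Fin n) k))}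
    (hπ : IsBlowup π (affineBlowup.idealSheaf (Ideal.span (Set.range K))))
    (hJ : ∀ g : ↥(Subgroup.zpowers σ),
      (affineBlowup.idealSheaf (Ideal.span (Set.range K))).comap (ρ g).hom =
        affineBlowup.idealSheaf (Ideal.span (Set.range K)))
    (g : ↥(Subgroup.zpowers σ)) (v : V) (hv : ((hπ.liftAction ρ hJ) g).hom.base v = v) :
    (Ideal.span (Set.range fun y =>
      (V.presheaf.stalkSpecializes (specializes_of_eq hv) ≫
        ((hπ.liftAction ρ hJ) g).hom.stalkMap v).hom y - y)).IsPrincipal := by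
  classical
  -- the germ map `(MvPolynomial (Fin n) k) → 𝒪_{𝔸ⁿ, π v}` and the action of `g⁻¹` on `(MvPolynomial (Fin n) k)`
  obtain ⟨γ, hγdef⟩ : ∃ γ : (MvPolynomial (Fin n) k) →+*
      (Spec (CommRingCat.of (MvPolynomial (Fin n) k))).presheaf.stalk (π.base v),
      γ = ((Scheme.ΓSpecIso (CommRingCat.of (MvPolynomial (Fin n) k))).inv ≫
        (Spec (CommRingCat.of (MvPolynomial (Fin n) k))).presheaf.germ ⊤ (π.base v) trivial).hom :=
    ⟨_, rfl⟩
  set φ : (MvPolynomial (Fin n) k) →+* (MvPolynomial (Fin n) k) := ((MulSemiringAction.toRingEquiv _ (MvPolynomial (Fin n) k) g⁻¹ : (MvPolynomial (Fin n) k) ≃+* (MvPolynomial (Fin n) k)) : (MvPolynomial (Fin n) k) →+* (MvPolynomial (Fin n) k)) with hφ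
  have hφapp : ∀ F : (MvPolynomial (Fin n) k), φ F = g⁻¹ • F := fun F => rfl
  by_cases hg : g = 1
  · -- `g = 1`: the lift is the identity and the ideal is `⊥`
    have hρg : (ρ g).hom = 𝟙 _ := by
      rw [hρ]
      have : ((MulSemiringAction.toRingEquiv _ (MvPolynomial (Fin n) k) g⁻¹ : (MvPolynomial (Fin n) k) ≃+* (MvPolynomial (Fin n) k)) : (MvPolynomial (Fin n) k) →+* (MvPolynomial (Fin n) k)) = RingHom.id _ := by
        refine RingHom.ext fun F => ?_
        change (MulSemiringAction.toRingEquiv _ _ g⁻¹) F = F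
        rw [MulSemiringAction.toRingEquiv_apply_apply, hg, inv_one, one_smul]
      rw [this, CommRingCat.ofHom_id, Spec.map_id]
    have hlift : (hπ.liftAction ρ hJ g).hom = 𝟙 _ :=
      hπ.eq_id_of_comp_eq (by rw [hπ.liftAction_hom_comp, hρg, Category.comp_id])
    have key : ∀ (f : V ⟶ V) (_ : f = 𝟙 V) (hvf : f.base v = v),
        Ideal.span (Set.range fun s : V.presheaf.stalk v =>
          (V.presheaf.stalkSpecializes (specializes_of_eq hvf) ≫ f.stalkMap v).hom s - s) = ⊥ := by
      intro f hf hvf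
      subst hf
      refine Ideal.span_eq_bot.mpr ?_
      rintro _ ⟨s, rfl⟩
      change ((𝟙 V : V ⟶ V).stalkMap v).hom
        ((V.presheaf.stalkSpecializes (specializes_of_eq hvf)).hom s) - s = 0
      erw [Scheme.Hom.stalkMap_id]
      rw [sub_eq_zero]
      exact stalkSpecializes_self_apply V.presheaf v _ s
    rw [key _ hlift hv]
    exact bot_isPrincipal
  -- `g ≠ 1`: `g⁻¹ = σᵐ` with `m` a unit in `k`
  have hg' : g⁻¹ ≠ 1 := fun h => hg (inv_eq_one.mp h)
  obtain ⟨m, hm, hmk⟩ := exists_pow_eq_of_ne_one k n σ a b c hab hac hb hc hσ g⁻¹ hg'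
  have hgXa : g⁻¹ • (X a : (MvPolynomial (Fin n) k)) = X a := by
    change ((g⁻¹ : Subgroup.zpowers σ) : (MvPolynomial (Fin n) k) ≃ₐ[k] (MvPolynomial (Fin n) k)) (X a) = X a
    rw [← hm]
    exact pow_apply_X_of_ne k n σ b c hσ m a hab hac
  have hgXb : g⁻¹ • (X b : (MvPolynomial (Fin n) k)) = X b + (m : (MvPolynomial (Fin n) k)) * X a := by
    change ((g⁻¹ : Subgroup.zpowers σ) : (MvPolynomial (Fin n) k) ≃ₐ[k] (MvPolynomial (Fin n) k)) (X b) = _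
    rw [← hm]
    exact pow_apply_X_b k n σ a b c hab hac hb hσ m
  -- the stalk of the centre is generated by the germs of the `K l`
  have hcK : Ideal.span (Set.range fun l => γ (K l)) =
      stalkIdeal (affineBlowup.idealSheaf (Ideal.span (Set.range K))) (π.base v) := by
    rw [stalkIdeal_eq_map_germ (affineBlowup.idealSheaf (Ideal.span (Set.range K)))
      ⟨⊤, isAffineOpen_top (Spec (CommRingCat.of (MvPolynomial (Fin n) k)))⟩ trivial]
    change _ = Ideal.map _ ((Scheme.IdealSheafData.ofIdealTop _).ideal
      ⟨⊤, isAffineOpen_top (Spec (CommRingCat.of (MvPolynomial (Fin n) k)))⟩)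
    rw [ideal_ofIdealTop_top, Ideal.map_map, Ideal.map_span, ← Set.range_comp, hγdef]
    rfl
  -- reduce to the chart package
  refine TerminalBlowup.stalkAug_of_chartPackage hπ (hπ.liftAction_hom_comp ρ hJ g) v hv
    (fun l => γ (K l)) hcK (fun I => I.IsPrincipal) ?_
  intro hs j 𝔴 χ hχ hloc hmax hab'
  -- notation for the stalk actions
  set aH := V.presheaf.stalkSpecializes (specializes_of_eq hv) ≫
    ((hπ.liftAction ρ hJ) g).hom.stalkMap v with haH
  set bH := (Spec (CommRingCat.of (MvPolynomial (Fin n) k))).presheaf.stalkSpecializes (specializes_of_eq hs) ≫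
    (ρ g).hom.stalkMap (π.base v) with hbH
  -- the stalk action of `ρ g` on germs is `g⁻¹`
  have key : ∀ (f : Spec (CommRingCat.of (MvPolynomial (Fin n) k)) ⟶ Spec (CommRingCat.of (MvPolynomial (Fin n) k)))
      (_ : f = Spec.map (CommRingCat.ofHom φ)) (hsf : f.base (π.base v) = π.base v) (F : (MvPolynomial (Fin n) k)),
      ((Spec (CommRingCat.of (MvPolynomial (Fin n) k))).presheaf.stalkSpecializes (specializes_of_eq hsf) ≫
        f.stalkMap (π.base v)).hom (γ F) = γ (φ F) := by
    intro f hf hsf F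
    subst hf
    rw [hγdef]
    exact TerminalBlowup.stalkAction_germ φ (π.base v) hsf F
  have hbγ : ∀ F : (MvPolynomial (Fin n) k), bH.hom (γ F) = γ (g⁻¹ • F) := fun F => key _ (hρ g) hs F
  -- (C) the chart relations `ι (K j) · χ (e_l) = ι (K l)` and `ι (K j)` is a non-zero-divisor
  have hrel : ∀ l : Fin 5, (π.stalkMap v).hom (γ (K j)) * χ (chartGen (fun l => γ (K l)) j l) =
      (π.stalkMap v).hom (γ (K l)) := fun l =>
    (congrArg (· * χ (chartGen (fun l => γ (K l)) j l)) (hχ (γ (K j))).symm).trans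
      (((map_mul χ _ _).symm.trans
        (congrArg χ (reesChartBase_apply_eq_mul_chartGen (fun l => γ (K l)) j l)).symm).trans
          (hχ (γ (K l))))
  have hTnzd : (π.stalkMap v).hom (γ (K j)) ∈ nonZeroDivisors (V.presheaf.stalk v) := by
    letI := χ.toAlgebra
    haveI : IsLocalization 𝔴.asIdeal.primeCompl (V.presheaf.stalk v) := hloc
    have h := IsLocalization.nonZeroDivisors_le_comap 𝔴.asIdeal.primeCompl (V.presheaf.stalk v)
      (reesChartBase_mem_nonZeroDivisors (γ (K j))
        (Ideal.mem_span_range_self (f := fun l => γ (K l)) (x := j)))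
    have hA : algebraMap (chartRing (fun l => γ (K l)) j) (V.presheaf.stalk v) = χ :=
      RingHom.algebraMap_toAlgebra χ
    have e : algebraMap (chartRing (fun l => γ (K l)) j) (V.presheaf.stalk v)
        (chartBase (fun l => γ (K l)) j (γ (K j))) = (π.stalkMap v).hom (γ (K j)) :=
      (congrArg (fun f : chartRing (fun l => γ (K l)) j →+* V.presheaf.stalk v =>
        f (chartBase (fun l => γ (K l)) j (γ (K j)))) hA).trans (hχ (γ (K j)))
    exact e ▸ (Submonoid.mem_comap.mp h)
  -- (A) the augmentation ideal upstairs = `(b r - r)·𝒪_{V,v} + (moves of the chart generators)`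
  have haug : Ideal.span (Set.range fun y => aH.hom y - y) =
      (Ideal.span (Set.range fun r => bH.hom r - r)).map (π.stalkMap v).hom ⊔
        Ideal.span (Set.range fun l : {l : Fin 5 // l ≠ j} =>
          aH.hom (χ (chartGen (fun l => γ (K l)) j l.1)) - χ (chartGen (fun l => γ (K l)) j l.1)) := by
    letI := χ.toAlgebra
    haveI : IsLocalization 𝔴.asIdeal.primeCompl (V.presheaf.stalk v) := hloc
    have hA : algebraMap (chartRing (fun l => γ (K l)) j) (V.presheaf.stalk v) = χ :=
      RingHom.algebraMap_toAlgebra χ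
    have hχ' : ∀ r, algebraMap (chartRing (fun l => γ (K l)) j) (V.presheaf.stalk v)
        (chartBase (fun l => γ (K l)) j r) = (π.stalkMap v).hom r := fun r =>
      (congrArg (fun f : chartRing (fun l => γ (K l)) j →+* V.presheaf.stalk v =>
        f (chartBase (fun l => γ (K l)) j r)) hA).trans (hχ r)
    have h := JordanThree.span_sub_eq_map_sup_span_of_chart (chartBase (fun l => γ (K l)) j)
      (fun l : {l : Fin 5 // l ≠ j} => chartGen (fun l => γ (K l)) j l.1)
      (eval₂Hom_chartGen_surjective (fun l => γ (K l)) j) 𝔴.asIdeal.primeCompl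
      (π.stalkMap v).hom hχ' bH.hom aH.hom hab'
    rw [hA] at h
    exact h
  -- (D) the augmentation ideal of `b` on `𝒪_{𝔸ⁿ,s}` is `(x_a, x_b)`
  have haugb : Ideal.span (Set.range fun r => bH.hom r - r) =
      (Ideal.span ({X a, X b} : Set (MvPolynomial (Fin n) k))).map γ := by
    apply le_antisymm
    · -- `⊆`: check on `k[x]` (ring maps out of a localisation)
      have hagree : (Ideal.Quotient.mk ((Ideal.span ({X a, X b} :
            Set (MvPolynomial (Fin n) k))).map γ)).comp bH.hom =
          Ideal.Quotient.mk ((Ideal.span ({X a, X b} : Set (MvPolynomial (Fin n) k))).map γ) := by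
        letI : Algebra (MvPolynomial (Fin n) k)
            ((Spec (CommRingCat.of (MvPolynomial (Fin n) k))).presheaf.stalk (π.base v)) :=
          StructureSheaf.stalkAlgebra (↑(CommRingCat.of (MvPolynomial (Fin n) k))) (π.base v)
        haveI : IsLocalization.AtPrime
            ((Spec (CommRingCat.of (MvPolynomial (Fin n) k))).presheaf.stalk (π.base v))
            (π.base v).asIdeal :=
          StructureSheaf.IsLocalization.to_stalk (↑(CommRingCat.of (MvPolynomial (Fin n) k)))
            (π.base v)
        have halg : ∀ F : MvPolynomial (Fin n) k, algebraMap (MvPolynomial (Fin n) k)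
            ((Spec (CommRingCat.of (MvPolynomial (Fin n) k))).presheaf.stalk (π.base v)) F =
            γ F := fun F => by rw [hγdef]; rfl
        apply IsLocalization.ringHom_ext (π.base v).asIdeal.primeCompl
          (S := (Spec (CommRingCat.of (MvPolynomial (Fin n) k))).presheaf.stalk (π.base v))
        refine RingHom.ext fun F => ?_
        simp only [RingHom.comp_apply, halg]
        rw [hbγ, Ideal.Quotient.eq, ← map_sub]
        exact Ideal.mem_map_of_mem γ (smul_sub_mem_centre k n σ a b c hb hc hσ g⁻¹ F)
      refine Ideal.span_le.mpr ?_
      rintro _ ⟨r, rfl⟩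
      have h := RingHom.congr_fun hagree r
      rw [RingHom.comp_apply, Ideal.Quotient.eq] at h
      exact h
    · -- `⊇`: `γ (g⁻¹ • F - F) = b (γ F) - γ F` and `(x_a, x_b) = ⟨g⁻¹ • F - F⟩`
      have e := congrArg (Ideal.map γ)
        (span_smul_sub_eq_centre k n σ a b c hab hac hb hc hσ g⁻¹ hg')
      rw [← e]
      refine Ideal.map_le_iff_le_comap.mpr (Ideal.span_le.mpr ?_)
      rintro _ ⟨F, rfl⟩
      rw [SetLike.mem_coe, Ideal.mem_comap, map_sub, ← hbγ]
      exact Ideal.subset_span ⟨γ F, rfl⟩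
  have hmapι : ((Ideal.span ({X a, X b} : Set (MvPolynomial (Fin n) k))).map γ).map
      (π.stalkMap v).hom =
      Ideal.span {(π.stalkMap v).hom (γ (X a)), (π.stalkMap v).hom (γ (X b))} := by
    rw [Ideal.map_map, Ideal.map_span, Set.image_insert_eq, Set.image_singleton]
    rfl
  have heq : Ideal.span (Set.range fun y => aH.hom y - y) =
      Ideal.span {(π.stalkMap v).hom (γ (X a)), (π.stalkMap v).hom (γ (X b))} ⊔
        Ideal.span (Set.range fun l : {l : Fin 5 // l ≠ j} =>
          aH.hom (χ (chartGen (fun l => γ (K l)) j l.1)) - χ (chartGen (fun l => γ (K l)) j l.1)) :=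
    haug.trans (congrArg₂ (· ⊔ ·)
      ((congrArg (Ideal.map (π.stalkMap v).hom) haugb).trans hmapι) rfl)
  rw [heq]
  -- (E) the hypotheses of the chart algebra, in `S = 𝒪_{V,v}`
  have h3 : (3 : V.presheaf.stalk v) = 0 := by
    have hk : (3 : k) = 0 := by simpa using CharP.cast_eq_zero k 3
    have h := congrArg
      (fun x : k => (π.stalkMap v).hom (γ (algebraMap k (MvPolynomial (Fin n) k) x))) hk
    simp only [map_ofNat, map_zero] at h
    exact h
  have hmS : IsUnit ((m : V.presheaf.stalk v)) := by
    have h := (((isUnit_iff_ne_zero.mpr hmk).map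
      (algebraMap k (MvPolynomial (Fin n) k))).map γ).map (π.stalkMap v).hom
    simpa using h
  have haXa : aH.hom ((π.stalkMap v).hom (γ (X a))) = (π.stalkMap v).hom (γ (X a)) := by
    rw [hab', hbγ, hgXa]
  have haXb : aH.hom ((π.stalkMap v).hom (γ (X b))) =
      (π.stalkMap v).hom (γ (X b)) + (m : V.presheaf.stalk v) * (π.stalkMap v).hom (γ (X a)) := by
    rw [hab', hbγ, hgXb, map_add, map_mul, map_natCast, map_add, map_mul, map_natCast]
  have hKl : ∀ l : Fin 5, (π.stalkMap v).hom (γ (K l)) =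
      ![(π.stalkMap v).hom (γ (X a)) ^ 4,
        (π.stalkMap v).hom (γ (X a)) ^ 3 * (π.stalkMap v).hom (γ (X b)),
        (π.stalkMap v).hom (γ (X a)) ^ 2 * (π.stalkMap v).hom (γ (X b)) ^ 3,
        (π.stalkMap v).hom (γ (X a)) * (π.stalkMap v).hom (γ (X b)) ^ 4,
        (π.stalkMap v).hom (γ (X b)) ^ 6] l := by
    intro l
    fin_cases l <;> simp [hK0, hK1, hK2, hK3, hK4, map_mul, map_pow]
  refine chart_isPrincipal ((π.stalkMap v).hom (γ (X a))) ((π.stalkMap v).hom (γ (X b)))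
    ((π.stalkMap v).hom (γ (K j))) (m : V.presheaf.stalk v)
    (fun l => χ (chartGen (fun l => γ (K l)) j l))
    aH.hom h3 hmS haXa haXb hTnzd j (hKl j) ?_ ?_ ?_ ?_ ?_
  · rw [hrel]; simpa using hKl 0
  · rw [hrel]; simpa using hKl 1
  · rw [hrel]; simpa using hKl 2
  · rw [hrel]; simpa using hKl 3
  · rw [hrel]; simpa using hKl 4

end Summit.ResolutionOfSingularities.ResolutionOfSingularities.Theorems.WildQuotientResolution.JordanThree.K3

end
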